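import Literature.Geometry.Lorentzian.HorizonPenetratingTeukolsky
import Literature.Barriers.FinalStateConjecture.ExtremalHorizonInstability
import HarnessLib

/-!
# Gravitational (`s = −2` Teukolsky) horizon hair on extremal Kerr — Lucietti–Reall, existence form

Topic `Geometry/Lorentzian` (next to `HorizonPenetratingTeukolsky.lean`, the Teukolsky vocabulary on the
horizon-penetrating charts `Kerr.region a r₀`). The catalogued scalar horizon instability of EXTREMAL Kerr
(`Literature.Barriers.FinalStateConjecture.AretakisInstability`, Aretakis 2015, Thm. 3: for `□_g ψ = 0`
the transversal derivative `Yψ` does not decay along `𝓗⁺`) has a gravitational analogue derived by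
Lucietti–Reall (PRD 86 (2012) 104030 = arXiv:1208.1437, §2.2, eqs. for `s ≤ 0`): restricting the
spin-`s` Teukolsky equation in Kerr coordinates `(v, r, θ, χ)` (tetrad `ℓ = Δ ℓ^K`, `n = Δ⁻¹ n^K`,
field `ψ = Δ^s ψ^K`, `ψ = Ψ₂^{−4/3} δΨ₄` for `s = −2`) to the extremal horizon `r = M = a` and
projecting on the spin-weighted harmonic `ₛY_{−s,0}` gives the conserved charge

  `I₀^{(s)} = ∫_{H(v)} dΩ (ₛY_{−s,0})^* { N(ψ) + 2a[(1 − 2s) − i s cos θ] ψ }`,  `N = 2(r² + a²)∂_r + a² sin²θ ∂_v`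

(transversal `N`), "independent of `v`, i.e. conserved along `𝓗⁺`", whence "if `s ≤ 0` then `ψ` and the
`j = −s` component of its transverse derivative `N(ψ)` cannot both decay along `𝓗⁺` as `v → ∞`" for data
with `I₀^{(s)} ≠ 0`, and such data exist in the admissible class (p. 6, Cauchy-evolution argument credited
to Dafermos). Reported in Dafermos, GRG 57 (2025), §5.1.

* `ExtremalKerrGravitationalHair` — the NAMED FACT (existence form, nothing asserted): on extremal Kerr
  `a = M > 0`, chart `Kerr.region M r₀` (`0 < r₀ < M`), there are an open `U ⊇ {r ≥ M, t* ≥ 0}`, a field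
  `α` and a `C^∞` tensor field `T` on `U` which off the axis and off `{Δ = 0}` is the horizon-regular
  rescaled tensorised field `Kerr.tensorise M (−2) (Kerr.rescale M M (−2) α)` (the device of
  `Kerr.IsAdmissibleTeukolskyFieldOn`: `T` is the honest `α̃ m ⊗ m` continued across `𝓗⁺`), solving
  `Kerr.teukolskyOpOn M M r₀ (−2) α = 0` on `U` off the axis and off `{Δ = 0}`, with data vanishing near
  the far part of the leaf `{t* = 0}`, and whose 1-jet `(T, dT)` does NOT decay along the horizon
  spheres `S_τ` (`Kerr.horizonSection`).
* Why the jet is read through `T` and not through `Kerr.rescale`: on `S_τ ⊆ {Δ = 0}` of extremal Kerr,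
  `Kerr.rescale M M (−2) α = (0⁻² · _) • α = 0` for EVERY `α` (Lean's `0⁻¹ = 0`;
  `Kerr.rescale_neg_two_eq_zero_of_mem_horizonSection`), so a clause `c ≤ ‖rescale α x‖ + ‖d(…) x‖` on `S_τ`
  would only be witnessed at exact zeros of the honest horizon field (`Kerr.tendsto_zero_of_rescale_jet_ge`).
* Why only an open `U ⊇ {r ≥ M, t* ≥ 0}` (the shape of `AretakisInstability`) and not the whole chart:
  for `0 < r₀ < M` the inner edge `{r = r₀}` of the chart is TIMELIKE (`Δ(r₀) = (r₀ − M)² > 0`), so a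
  smooth solution on all of `{r > r₀}` for all `t* ∈ ℝ` is an initial-boundary-value statement printed
  nowhere; the printed content lives on `J⁺` of the leaf in the black-hole exterior up to and including `𝓗⁺`.

Scope caveats (as for the scalar fact): existence form (one witness) instead of the printed universality
over data with `I₀^{(−2)} ≠ 0`; the charges `I_p^{(s)}` themselves are not formalised; the existence of the
smooth solution from admissible data is standard linear theory assumed, not carried out, in the source
("proving this would involve a detailed global analysis" refers to DECAY of `ψ`, which the 1-jet form does
not need); identification of `ψ` with `α̃` up to the smooth non-vanishing factor `Ψ₂^{−4/3}` and of the Kerr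
coordinates of the source with the tree's Kerr–Schild chart argued here, not proved. Nothing is asserted.

## References

* J. Lucietti, H. S. Reall, *Gravitational instability of an extreme Kerr black hole*, Phys. Rev. D 86
  (2012) 104030, arXiv:1208.1437, §2.2 (pp. 5–7 read 2026-08-16). [LuciettiReall2012]
* M. Dafermos, *The stability problem for extremal black holes*, Gen. Relativity Gravitation 57 (2025),
  §5.1. [Dafermos2025]
* S. Aretakis, Adv. Theor. Math. Phys. 19 (2015), Thm. 3. [Aretakis2015]
* B. O'Neill, *The geometry of Kerr black holes* (1995), Ch. 2, §2.3. [ONeill1995]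
-/

noncomputable section

open Set Function Filter
open scoped Manifold ContDiff Topology

namespace Literature.Geometry.Lorentzian.Kerr

open Literature.Barriers.FinalStateConjecture

/-- On extremal Kerr `a = M` the horizon function vanishes on the horizon spheres:
`Δ(M) = M² − 2M·M + M² = 0`. O'Neill 1995, Ch. 2, §2.3. [cite: ONeill1995, Ch. 2 §2.3] -/
theorem delta_self_eq_zero_of_mem_horizonSection {M r₀ τ : ℝ} {x : Kerr.region M r₀}
    (hx : x ∈ Kerr.horizonSection M M r₀ τ) :
    Kerr.delta M M (Kerr.radius M (x : E4)) = 0 := by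
  rw [mem_horizonSection_extremal] at hx
  rw [hx.1]
  unfold Kerr.delta
  ring

/-- **The junk value.** For EVERY field `α`, the rescaled field `Kerr.rescale M M (-2) α = Δ⁻² • α`
vanishes identically on every horizon sphere `S_τ` of extremal Kerr (Lean's `0⁻¹ = 0`), so the
value term of a non-decay clause written with `Kerr.rescale` is `0` there; this is why the fact below reads the
1-jet through the smooth extension `T`. [folklore] -/
theorem rescale_neg_two_eq_zero_of_mem_horizonSection {M r₀ τ : ℝ} (α : Kerr.region M r₀ → ℂ)
    {x : Kerr.region M r₀} (hx : x ∈ Kerr.horizonSection M M r₀ τ) :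
    Kerr.rescale M M (-2) α x = 0 := by
  have hΔ := delta_self_eq_zero_of_mem_horizonSection hx
  simp only [Kerr.rescale, hΔ]
  have h0 : (0 : ℝ) ^ (-2 : ℤ) = 0 := zero_zpow (-2) (by norm_num)
  rw [h0, zero_mul, zero_smul]

/-- An integrand `‖α̃ x‖ + ‖d(extend α̃) x‖` written with `Kerr.rescale` on `S_τ` reduces to the derivative term alone. [folklore] -/
theorem rescale_jet_integrand_eq {M r₀ τ : ℝ} (α : Kerr.region M r₀ → ℂ)
    {x : Kerr.region M r₀} (hx : x ∈ Kerr.horizonSection M M r₀ τ) :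
    ‖Kerr.rescale M M (-2) α x‖ +
        ‖fderiv ℝ (Function.extend Subtype.val (Kerr.rescale M M (-2) α) 0) (x : E4)‖ =
      ‖fderiv ℝ (Function.extend Subtype.val (Kerr.rescale M M (-2) α) 0) (x : E4)‖ := by
  rw [rescale_neg_two_eq_zero_of_mem_horizonSection α hx, norm_zero, zero_add]

/-- **Why the fact is NOT written with `Kerr.rescale` on the horizon.** If the integrand
`‖rescale α x‖ + ‖d(extend (rescale α)) x‖` is `≥ c > 0` at a horizon point `x ∈ S_τ`, then the
zero-extension of `Kerr.rescale M M (-2) α` is differentiable, hence continuous, at `x` with value `0`: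
the honest rescaled field `α̃ = Δ⁻² α` (off the horizon, where `rescale` is not junk) must TEND TO ZERO
at every such point — such a clause could only be witnessed at exact zeros of the horizon field and is
blind to the value of the smooth extension `T` on `S_τ`; it would not be the printed non-decay of the
1-jet `(ψ, Nψ)`. [folklore] -/
theorem tendsto_zero_of_rescale_jet_ge {M r₀ τ c : ℝ} (hc : 0 < c) (α : Kerr.region M r₀ → ℂ)
    {x : Kerr.region M r₀} (hx : x ∈ Kerr.horizonSection M M r₀ τ)
    (h : c ≤ ‖Kerr.rescale M M (-2) α x‖ +
        ‖fderiv ℝ (Function.extend Subtype.val (Kerr.rescale M M (-2) α) 0) (x : E4)‖) :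
    DifferentiableAt ℝ (Function.extend Subtype.val (Kerr.rescale M M (-2) α) 0) (x : E4) ∧
      Filter.Tendsto (Function.extend Subtype.val (Kerr.rescale M M (-2) α) 0) (𝓝 (x : E4))
        (𝓝 0) := by
  set g := Function.extend Subtype.val (Kerr.rescale M M (-2) α) (0 : E4 → ℂ) with hg
  rw [rescale_jet_integrand_eq α hx] at h
  have hne : fderiv ℝ g (x : E4) ≠ 0 := fun h0 ↦ by
    rw [h0, norm_zero] at h
    exact absurd h (not_le.mpr hc)
  have hd : DifferentiableAt ℝ g (x : E4) := by
    by_contra hnd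
    exact hne (fderiv_zero_of_not_differentiableAt hnd)
  have hgx : g (x : E4) = 0 := by
    rw [hg, Subtype.val_injective.extend_apply]
    exact rescale_neg_two_eq_zero_of_mem_horizonSection α hx
  refine ⟨hd, ?_⟩
  simpa [hgx] using hd.continuousAt.tendsto

/-- **Gravitational horizon hair of extremal Kerr (Lucietti–Reall), existence form — NAMED FACT, nothing
asserted.** For every `M > 0` and `r₀ ∈ (0, M)`, on the horizon-penetrating Kerr–Schild chart
`Kerr.region M r₀` of EXTREMAL Kerr `a = M` (event horizon `{r = M}`, `Kerr.rPlus_self`) there are an open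
set `U` containing `{x | M ≤ r(x) ∧ 0 ≤ t*(x)}`, a complex field `α` and a `C^∞` tensor field
`T : U → ℂ^{4×4}` such that: off the axis and off `{Δ = 0}`, `T` is the horizon-regular rescaled tensorised
spin `−2` field `Kerr.tensorise M (−2) (Kerr.rescale M M (−2) α)`; `α` solves the spin `−2` Teukolsky
equation `Kerr.teukolskyOpOn M M r₀ (−2) α = 0` on `U` off the axis and off `{Δ = 0}`; `T` vanishes near
the far part `{t* = 0, r ≥ R}` of the initial leaf (localised data); and the 1-jet of `T` does not decay
along the horizon: some `c > 0` bounds `‖T x‖ + ‖d(extend T) x‖` from below at a point `x` of arbitrarily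
late horizon spheres `S_τ = {r = M, t* = τ}`. Source: "the quantity `I₀^{(s)}` … is conserved along `𝓗⁺`
… It follows that `ψ` and the `j = −s` component of its transverse derivative `N(ψ)` do not both decay
along `𝓗⁺` as `v → ∞`" for generic (`I₀^{(s)} ≠ 0`) admissible data, `s ≤ 0`, here `s = −2`,
`ψ = Ψ₂^{−4/3} δΨ₄ = Δ^{−2} ψ^K` (the tree's `rescale … (−2)` up to a smooth non-vanishing factor).
Existence of the smooth solution from such data is standard linear theory, assumed as in the source.
[cite: LuciettiReall2012, §2.2] -/
def ExtremalKerrGravitationalHair : Prop :=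
  ∀ [Kerr.Facts] (M : ℝ), 0 < M → ∀ r₀ ∈ Set.Ioo 0 M, ∀ [(Kerr.metric M M r₀).HasLeviCivita],
    ∃ (U : Set (Kerr.region M r₀)) (α : Kerr.region M r₀ → ℂ)
      (T : Kerr.region M r₀ → Fin 4 → Fin 4 → ℂ),
      IsOpen U ∧
      {x : Kerr.region M r₀ | M ≤ Kerr.radius M (x : E4) ∧ 0 ≤ (x : E4) 0} ⊆ U ∧
      ContMDiffOn 𝓘(ℝ, E4) 𝓘(ℝ, Fin 4 → Fin 4 → ℂ) ∞ T U ∧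
      (∀ x ∈ U, (x : E4) ∉ Kerr.axis → Kerr.delta M M (Kerr.radius M (x : E4)) ≠ 0 →
        T x = Kerr.tensorise M (-2) (Kerr.rescale M M (-2) α) x) ∧
      (∀ x ∈ U, (x : E4) ∉ Kerr.axis → Kerr.delta M M (Kerr.radius M (x : E4)) ≠ 0 →
        Kerr.teukolskyOpOn M M r₀ (-2) α x = 0) ∧
      (∃ (R : ℝ) (V : Set (Kerr.region M r₀)), IsOpen V ∧
        {x : Kerr.region M r₀ | (x : E4) 0 = 0 ∧ R ≤ Kerr.radius M (x : E4)} ⊆ V ∧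
        ∀ x ∈ V, T x = 0) ∧
      ∃ c : ℝ, 0 < c ∧ ∀ τ₀ : ℝ, ∃ τ : ℝ, τ₀ ≤ τ ∧
        ∃ x ∈ Literature.Barriers.FinalStateConjecture.Kerr.horizonSection M M r₀ τ,
          c ≤ ‖T x‖ + ‖fderiv ℝ (Function.extend Subtype.val T 0) (x : E4)‖

/-- Unpacking: under the fact, for extremal parameters there is a localised spin `−2` solution near and
on the future event horizon whose 1-jet, read through its smooth horizon extension, is bounded below by a
positive constant at points of arbitrarily late horizon spheres. [cite: LuciettiReall2012, §2.2] -/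
theorem ExtremalKerrGravitationalHair.exists_nondecaying (h : ExtremalKerrGravitationalHair) [Kerr.Facts]
    {M : ℝ} (hM : 0 < M) {r₀ : ℝ} (hr₀ : r₀ ∈ Set.Ioo 0 M) [(Kerr.metric M M r₀).HasLeviCivita] :
    ∃ (U : Set (Kerr.region M r₀)) (T : Kerr.region M r₀ → Fin 4 → Fin 4 → ℂ), IsOpen U ∧
      {x : Kerr.region M r₀ | M ≤ Kerr.radius M (x : E4) ∧ 0 ≤ (x : E4) 0} ⊆ U ∧
      ContMDiffOn 𝓘(ℝ, E4) 𝓘(ℝ, Fin 4 → Fin 4 → ℂ) ∞ T U ∧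
      ∃ c : ℝ, 0 < c ∧ ∀ τ₀ : ℝ, ∃ τ : ℝ, τ₀ ≤ τ ∧
        ∃ x ∈ Literature.Barriers.FinalStateConjecture.Kerr.horizonSection M M r₀ τ,
          c ≤ ‖T x‖ + ‖fderiv ℝ (Function.extend Subtype.val T 0) (x : E4)‖ := by
  obtain ⟨U, α, T, hU, hsub, hT, -, -, -, hnd⟩ := h M hM r₀ hr₀
  exact ⟨U, T, hU, hsub, hT, hnd⟩

end Literature.Geometry.Lorentzian.Kerr

end
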